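import Summits.NavierStokesRegularity.NavierStokesRegularity.Theorems.PeepholeVorticityDoorDefs
import Literature.Analysis.FluidPDE.SwirlTransportProofs

/-!
# Door S29 `PeepholeVorticityDoor` (residual hard core `NoTypeII`, stmt-NavierStokesRegularity-0056) — negative edge:
# the EXPLICIT transfer lemma `PeepholeToCoreExplicit` AS TYPED (`Theorems/PeepholeVorticityDoorDefs.lean` §2b, l.155) is FALSE

Negative-side record (refuter seat ns-regularity-refuter1 g9, KILLSHEET K-61; D-0081 §C), landing the planner's kernel-checked
erratum witness (nsreg-p1 g23, S29 ERRATUM 1 §E1, `r27/NotExplicit29.lean` sha16 db3a052fc39c1b25, declarations verbatim;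
independently re-read against the tree text and re-checked on the farm by the refuter).

CLASS: refuted-MISSTATED (a typed `def`, asserted by no tree theorem; it is only the ANTECEDENT of
`peepholeToCore_of_explicit`, `targetPeepholeVorticity_of`, `targetPeepholeVorticity_of_int`, which stay true and become
vacuous).  The slip is a junk value of the explicit lateness: `t1S29 A R ‖y₀‖ c₁ = min 1 ((c₁/(A·D))²)` with `c₁` quantified
AFTER `A`, so `c₁ ≥ A·D` gives lateness `1`; then a slice `tb < −1/(1+τ)` is admissible and the whole conclusion window
`[(1+2τ)tb, (1+τ)tb]` lies in `{t < −1}`, where NO hypothesis constrains `u` (the region predicate, the Type-I bound (1.15) and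
the two gradient bounds all live on `t ∈ [−1,0)`).
WITNESS (data `C_u = θ = K = K₂ = r = 1`, `R = 2`, `y₀ = 0` ⇒ `D = 5`; `c₁ = 5A` ⇒ `t1S29 = 1`; `τ = tauS29 1 1 = 1/8000`;
`tb = −99999/100000`, window `⊂ {t ≤ −1 − 1/10000}`): `p = 0`, `u t x = (N · stepE1 t) • rotGen x` with `stepE1` a
`Real.smoothTransition` step (`0` for `t ≥ −1 − 1/20000`, `1` for `t ≤ −1 − 1/10000`) — identically zero on the region (so a
classical solution there with every bound and an `ε`-small peephole at `tb`), a rigid rotation of amplitude `N` in the window,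
where `(curl u) x 2 = 2N` forces `∫_{B(0, 4√(−t'))} ‖curl u(t')‖² ≥ (2N)² |B(0,4)| > 1/4 ≥ θ²/(4√(−t'))`.
REPAIRED STATEMENT C′ (believed true, = the door's target of record): the EXISTENTIAL `PeepholeToCore` (same file, l.97:
`∃ T₁, 0 < T₁ ∧ T₁ ≤ 1` chosen AFTER `τ`, so a proof may take `T₁ ≤ 1/(1+2τ)` and keep the window inside `(−1,0)`), or the
planner's explicit rev. 2 `PeepholeToCoreExplicit'` with lateness `t1S29' = min (1/2) ((min c₁ 1)²/(A²(D²+L₀))) ≤ 1/2`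
(`r27/Sketch29b.lean` sha16 2b680a5c89071ed0, not in the tree).  The witness MISSES C′: once `(1+2τ)tb ≥ −1` the window lies in
`[−1,0)`, where the witness vanishes and the conclusion `0 ≤ θ²/(4√(−t'))` holds.  Minimal textual repair of l.155: replace
`Ioo (-(t1S29 A R ‖y₀‖ c₁)) 0` by `Ioo (-(min (1/2) (t1S29 A R ‖y₀‖ c₁))) 0`.
CONSEQUENCE FOR THE LINE: none for the door — `targetPeepholeVorticity_of_peepholeToCore : PeepholeToCore → TargetPeepholeVorticity`
(`Theorems/PeepholeVorticityDoorFrame.lean`) consumes the existential form; S29 FILE 2 must target `peepholeToCore_holds :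
PeepholeToCore`, never the typed explicit form (DIRECTOR-NS #122 (3) as amended 04:11:41Z).
WHAT THIS IS NOT: not a claim about Navier–Stokes regularity or blow-up; no landed theorem is false; not a refutation of the
door S29 or of item 0056 — a kernel-checked record that one typed explicit constant is junk-valued. [folklore]
-/

noncomputable section

set_option linter.dupNamespace false

namespace Summit.NavierStokesRegularity.NavierStokesRegularity.Theorems.PeepholeVorticityDoor.Negative

open MeasureTheory Set Function Filter Topology TopologicalSpace Metric
open scoped RealInnerProductSpace NNReal ENNReal Topology ContDiff
open Literature.Analysis Literature.Analysis.FluidPDE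

/-! ## The witness -/

/-- the smooth time step of the E1 witness: `0` for `t ≥ −1 − 1/20000`, `1` for `t ≤ −1 − 1/10000`. -/
def stepE1 (t : ℝ) : ℝ := Real.smoothTransition ((-(1 + 1 / 20000 : ℝ) - t) * 20000)

/-- the time step is smooth. -/
theorem stepE1_contDiff {n : ℕ∞} : ContDiff ℝ n stepE1 :=
  Real.smoothTransition.contDiff.comp ((contDiff_const.sub contDiff_id).mul contDiff_const)

/-- the time step vanishes for `t ≥ −1 − 1/20000`. -/
theorem stepE1_eq_zero {t : ℝ} (ht : -(1 + 1 / 20000 : ℝ) ≤ t) : stepE1 t = 0 :=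
  Real.smoothTransition.zero_of_nonpos (by nlinarith)

/-- the time step equals `1` for `t ≤ −1 − 1/10000`. -/
theorem stepE1_eq_one {t : ℝ} (ht : t ≤ -(1 + 1 / 10000 : ℝ)) : stepE1 t = 1 :=
  Real.smoothTransition.one_of_one_le (by nlinarith)

/-- the E1 witness velocity: a rigid rotation of amplitude `N`, switched on only below `t = −1 − 1/20000`. -/
def uE1 (N : ℝ) (t : ℝ) (x : EuclideanSpace ℝ (Fin 3)) : EuclideanSpace ℝ (Fin 3) :=
  (N * stepE1 t) • rotGen x

/-- the witness vanishes identically for `t ≥ −1 − 1/20000` (in particular on the region `t ∈ [−1,0)`). -/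
theorem uE1_eq_zero (N : ℝ) {t : ℝ} (ht : -(1 + 1 / 20000 : ℝ) ≤ t) :
    uE1 N t = fun _ => 0 := by
  funext x; simp [uE1, stepE1_eq_zero ht]

/-- the witness is the rigid rotation `N • rotGen` for `t ≤ −1 − 1/10000` (the whole conclusion window). -/
theorem uE1_eq_rot (N : ℝ) {t : ℝ} (ht : t ≤ -(1 + 1 / 10000 : ℝ)) :
    uE1 N t = fun x => N • rotGen x := by
  funext x; simp [uE1, stepE1_eq_one ht]

/-- the witness is jointly smooth in `(t, x)`. -/
theorem contDiff_uncurry_uE1 (N : ℝ) {n : ℕ∞} : ContDiff ℝ n (uncurry (uE1 N)) := by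
  have h1 : ContDiff ℝ n fun q : ℝ × EuclideanSpace ℝ (Fin 3) => N * stepE1 q.1 :=
    contDiff_const.mul (stepE1_contDiff.comp contDiff_fst)
  have h2 : ContDiff ℝ n fun q : ℝ × EuclideanSpace ℝ (Fin 3) => rotGenL q.2 :=
    rotGenL.contDiff.comp contDiff_snd
  have h3 : uncurry (uE1 N) = fun q : ℝ × EuclideanSpace ℝ (Fin 3) => (N * stepE1 q.1) • rotGenL q.2 := by
    funext q; rfl
  rw [h3]
  exact h1.smul h2

/-- the curl of the zero field vanishes. -/
theorem curl_fun_zero (x : EuclideanSpace ℝ (Fin 3)) :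
    curl (fun _ : EuclideanSpace ℝ (Fin 3) => (0 : EuclideanSpace ℝ (Fin 3))) x = 0 := by
  ext i
  fin_cases i <;> simp [curl]

/-- the axial component of the curl of the rigid rotation `N • rotGen` is `2N`. -/
theorem curl_smul_rotGen_apply_two (N : ℝ) (x : EuclideanSpace ℝ (Fin 3)) :
    curl (fun y : EuclideanSpace ℝ (Fin 3) => N • rotGen y) x 2 = 2 * N := by
  have hfd : fderiv ℝ (fun y : EuclideanSpace ℝ (Fin 3) => N • rotGen y) x = N • rotGenL :=
    ((hasFDerivAt_rotGen x).const_smul N).fderiv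
  simp only [curl, hfd]
  simp [rotGen]
  ring

/-- hence `2N ≤ ‖curl (N • rotGen) x‖` for `N ≥ 0`. -/
theorem two_mul_le_norm_curl_smul_rotGen {N : ℝ} (hN : 0 ≤ N) (x : EuclideanSpace ℝ (Fin 3)) :
    2 * N ≤ ‖curl (fun y : EuclideanSpace ℝ (Fin 3) => N • rotGen y) x‖ := by
  have h := PiLp.norm_apply_le (curl (fun y : EuclideanSpace ℝ (Fin 3) => N • rotGen y) x) 2
  rw [curl_smul_rotGen_apply_two, Real.norm_eq_abs, abs_of_nonneg (by linarith)] at h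
  exact h

/-! ## The refutation -/

/-- **E1.** `PeepholeToCoreExplicit` as typed (lateness `t1S29 = min 1 …`) is false.  class: misstated;
repaired: `PeepholeToCoreExplicit'` (lateness `t1S29' ≤ 1/2`, r27/Sketch29b.lean). -/
theorem not_peepholeToCoreExplicit : ¬ PeepholeToCoreExplicit := by
  rintro ⟨A, hA, h⟩
  -- the volume of `B(0,4) ⊂ ℝ³` as a positive real, and an amplitude `N` beating it
  set V : ℝ := (volume (ball (0 : EuclideanSpace ℝ (Fin 3)) 4)).toReal with hV
  have hVtop : volume (ball (0 : EuclideanSpace ℝ (Fin 3)) 4) ≠ ⊤ := measure_ball_lt_top.ne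
  have hVpos : 0 < V := ENNReal.toReal_pos (measure_ball_pos volume _ (by norm_num)).ne' hVtop
  obtain ⟨n, hn⟩ := exists_nat_gt (1 / V)
  set N : ℝ := (n : ℝ) + 1 with hNdef
  have hN1 : 1 ≤ N := by have : (0 : ℝ) ≤ n := n.cast_nonneg; linarith
  have hN0 : 0 ≤ N := by linarith
  have hNV : 1 < N * V := by
    have h1 : 1 < (n : ℝ) * V := by
      have := (div_lt_iff₀ hVpos).mp hn
      linarith
    nlinarith
  -- constants of the statement at the chosen data
  have ht1 : t1S29 A 2 ‖(0 : EuclideanSpace ℝ (Fin 3))‖ (5 * A) = 1 := by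
    unfold t1S29 dS29
    rw [norm_zero]
    have hA0 : A ≠ 0 := hA.ne'
    have : (5 * A / (A * (0 + 2 * 2 + 1))) ^ 2 = (1 : ℝ) := by
      field_simp
      ring
    rw [this, min_self]
  have htau : tauS29 1 1 = 1 / 8000 := by
    unfold tauS29 tcS29
    norm_num
  -- the witness is a classical solution on the region (it vanishes identically there)
  have hsol : IsClassicalNSSolutionOnRegion
      (Ico (-1 : ℝ) 0 ×ˢ ball (0 : EuclideanSpace ℝ (Fin 3)) 1) 1 0 (uE1 N) (fun _ _ => 0) := by
    refine ⟨(contDiff_uncurry_uE1 N).contDiffOn, contDiffOn_const, ?_, ?_⟩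
    · intro t x htx
      obtain ⟨ht, hx⟩ := mem_prod.mp htx
      have ht1' : -(1 + 1 / 20000 : ℝ) ≤ t := by linarith [ht.1]
      have hderiv :
          timeDerivOn (Ico (-1 : ℝ) 0 ×ˢ ball (0 : EuclideanSpace ℝ (Fin 3)) 1) (uE1 N) t x = 0 := by
        rw [timeDerivOn_apply]
        have hev : (fun s => uE1 N s x)
            =ᶠ[𝓝[timeSection (Ico (-1 : ℝ) 0 ×ˢ ball (0 : EuclideanSpace ℝ (Fin 3)) 1) x] t]
            fun _ => (0 : EuclideanSpace ℝ (Fin 3)) := by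
          have hmem : Ioi (-(1 + 1 / 20000 : ℝ)) ∈
              𝓝[timeSection (Ico (-1 : ℝ) 0 ×ˢ ball (0 : EuclideanSpace ℝ (Fin 3)) 1) x] t :=
            mem_nhdsWithin_of_mem_nhds (Ioi_mem_nhds (by linarith [ht.1]))
          filter_upwards [hmem] with s hs
          simp [uE1, stepE1_eq_zero (le_of_lt hs)]
        rw [hev.derivWithin_eq (by simp [uE1, stepE1_eq_zero ht1'])]
        simp
      rw [hderiv, uE1_eq_zero N ht1']
      simp [gradient_fun_const]
    · intro t x htx
      obtain ⟨ht, hx⟩ := mem_prod.mp htx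
      rw [uE1_eq_zero N (by linarith [ht.1])]
      simp [VectorCalculus.divergence]
  -- the remaining hypotheses are vacuous on the witness (it vanishes for `t ≥ −1 − 1/20000`)
  have h115 : ∀ t ∈ Ico (-1 : ℝ) 0, ∀ x ∈ ball (0 : EuclideanSpace ℝ (Fin 3)) 1,
      ‖uE1 N t x‖ ≤ 1 / (Real.sqrt (-t) + ‖x‖) := by
    intro t ht x hx
    rw [uE1_eq_zero N (by linarith [ht.1])]
    have : 0 < Real.sqrt (-t) := Real.sqrt_pos.mpr (by linarith [ht.2])
    simp only [norm_zero]
    positivity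
  have hg1 : ∀ t ∈ Ioo (-1 : ℝ) 0, ∀ x : EuclideanSpace ℝ (Fin 3), ‖x‖ + Real.sqrt (-t) ≤ 5 * A →
      ‖fderiv ℝ (uE1 N t) x‖ ≤ 1 / (‖x‖ + Real.sqrt (-t)) ^ 2 := by
    intro t ht x _
    rw [uE1_eq_zero N (by linarith [ht.1])]
    simp only [fderiv_fun_const, Pi.zero_apply, norm_zero]
    positivity
  have hg2 : ∀ t ∈ Ioo (-1 : ℝ) 0, ∀ x : EuclideanSpace ℝ (Fin 3), ‖x‖ + Real.sqrt (-t) ≤ 5 * A →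
      ‖iteratedFDeriv ℝ 2 (uE1 N t) x‖ ≤ 1 / (‖x‖ + Real.sqrt (-t)) ^ 3 := by
    intro t ht x _
    rw [uE1_eq_zero N (by linarith [ht.1])]
    simp only [iteratedFDeriv_fun_zero, Pi.zero_apply, norm_zero]
    positivity
  -- the admissible slice `tb = −99999/100000 > −t1S29 = −1`
  have htb : (-(99999 / 100000) : ℝ) ∈ Ioo (-(t1S29 A 2 ‖(0 : EuclideanSpace ℝ (Fin 3))‖ (5 * A))) 0 := by
    rw [ht1]; constructor <;> norm_num
  have hpeep : ∀ x ∈ ball (Real.sqrt (-(-(99999 / 100000) : ℝ)) • (0 : EuclideanSpace ℝ (Fin 3)))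
        (Real.sqrt (-(-(99999 / 100000) : ℝ)) * 1),
      (-(-(99999 / 100000) : ℝ)) * ‖curl (uE1 N (-(99999 / 100000))) x‖ ≤
        epsS29 A 1 1 1 1 2 ‖(0 : EuclideanSpace ℝ (Fin 3))‖ 1 := by
    intro x _
    rw [uE1_eq_zero N (by norm_num), curl_fun_zero, norm_zero, mul_zero]
    unfold epsS29
    positivity
  -- apply the statement
  obtain ⟨t', ht', hle⟩ := h 1 one_pos 1 one_pos 2 le_rfl 1 1 one_pos one_pos 0 1 one_pos (5 * A)
    (by positivity) (uE1 N) (fun _ _ => 0) hsol h115 hg1 hg2 _ htb hpeep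
  -- the window lies below `t = −1 − 1/10000`, where the witness is the rigid rotation
  have ht'le : t' ≤ -(1 + 1 / 10000 : ℝ) := by
    have h2 := ht'.2
    rw [htau] at h2
    linarith
  have hneg : 1 ≤ -t' := by linarith
  have hsqrt : 1 ≤ Real.sqrt (-t') := by
    rw [show (1 : ℝ) = Real.sqrt 1 from Real.sqrt_one.symm]
    exact Real.sqrt_le_sqrt hneg
  rw [uE1_eq_rot N ht'le] at hle
  -- lower bound of the left-hand side: `(2N)² · |B(0,4)|`
  have hsub : ball (0 : EuclideanSpace ℝ (Fin 3)) 4 ⊆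
      ball (0 : EuclideanSpace ℝ (Fin 3)) (2 * 2 * Real.sqrt (-t')) :=
    ball_subset_ball (by linarith)
  have hlow : ENNReal.ofReal ((2 * N) ^ 2) * volume (ball (0 : EuclideanSpace ℝ (Fin 3)) 4) ≤
      ∫⁻ x in ball (0 : EuclideanSpace ℝ (Fin 3)) (2 * 2 * Real.sqrt (-t')),
        ENNReal.ofReal (‖curl (fun y : EuclideanSpace ℝ (Fin 3) => N • rotGen y) x‖ ^ 2) := by
    calc ENNReal.ofReal ((2 * N) ^ 2) * volume (ball (0 : EuclideanSpace ℝ (Fin 3)) 4)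
        ≤ ENNReal.ofReal ((2 * N) ^ 2) *
            volume (ball (0 : EuclideanSpace ℝ (Fin 3)) (2 * 2 * Real.sqrt (-t'))) := by
          gcongr
      _ = ∫⁻ _ in ball (0 : EuclideanSpace ℝ (Fin 3)) (2 * 2 * Real.sqrt (-t')),
            ENNReal.ofReal ((2 * N) ^ 2) := (setLIntegral_const _ _).symm
      _ ≤ _ := by
          apply lintegral_mono
          intro x
          exact ENNReal.ofReal_le_ofReal
            (pow_le_pow_left₀ (by linarith) (two_mul_le_norm_curl_smul_rotGen hN0 x) 2)
  -- upper bound of the right-hand side: `1/4`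
  have hup : ENNReal.ofReal ((1 : ℝ) ^ 2 / (4 * Real.sqrt (-t'))) ≤ ENNReal.ofReal (1 / 4) := by
    apply ENNReal.ofReal_le_ofReal
    rw [one_pow]
    exact one_div_le_one_div_of_le (by norm_num) (by linarith)
  -- contradiction: `4 N² V ≤ 1/4` with `N V > 1`, `N ≥ 1`
  have hfin : ENNReal.ofReal ((2 * N) ^ 2 * V) ≤ ENNReal.ofReal (1 / 4) := by
    have hvol : volume (ball (0 : EuclideanSpace ℝ (Fin 3)) 4) = ENNReal.ofReal V := by
      rw [hV, ENNReal.ofReal_toReal hVtop]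
    have := (hlow.trans hle).trans hup
    rwa [hvol, ← ENNReal.ofReal_mul (by positivity)] at this
  have hreal : (2 * N) ^ 2 * V ≤ 1 / 4 := (ENNReal.ofReal_le_ofReal_iff (by norm_num)).mp hfin
  nlinarith

end Summit.NavierStokesRegularity.NavierStokesRegularity.Theorems.PeepholeVorticityDoor.Negative

end
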